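import Summits.HodgeConjecture.CorCM.Census.CyclicCharacterFibre

/-!
# Cyclic characters `w : G → ℤ/2ᵏ` non-zero on `c`, II: THE LAW `φ₂(G, c) + 2 = β(G, c) + d`, the odd-kernel law `φ₂ + 1 = β`,
# Burnside for the odd kernel, and the floors

COR-CM (cell `pub-hodgecm2`), count-neutral kernel combinatorics by the binder seat b09 (gen 41; lane CYCLIC-CHARACTER FIBRE LAW, part II of
II), on top of part I (`Census/CyclicCharacterFibre.lean`: roots, the even part, `d₂(G/𝒦) ∈ {0,1}`), the closed form of the coinvariant fibre
(`Census/TypeStabiliserCharK.fibreTwo_add_eq_card_block_add_indexTwoRank`: `φ₂ + 1 + [|G|/2 even] = β + d₂(G/𝒦)`), THE COINVARIANT FLOOR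
(`Census/CoinvariantFloor.fibreTwo_le_card`) and Burnside for blocks (`Census/BlockParityBurnside.card_block_mul_card`), all BY NAME; theorems only
(no definition, no `decide`, no certificate, no named fact, no `sorry`).  HONEST FRAMING: `HC_CM` is NOT proved, here or anywhere in the
tree; nothing here is a period or a headline.

THE LAW (§2).  `G` finite, `c` a central involution, `w : G → ℤ/2ᵏ` additive with `k ≥ 2`, onto (`∃ g, w g = 1`), `w c ≠ 0`; `d := [every g with
w g odd is a root of c]`.  Then

  **`φ₂(G, c) + 1 = β(G, c)`** if every `g` with `w g` odd has `c ∈ ⟨g⟩`     (`fibreTwo_add_one_eq_card_block`),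
  **`φ₂(G, c) + 2 = β(G, c)`** if some `g` with `w g` odd has `c ∉ ⟨g⟩`      (`fibreTwo_add_two_eq_card_block`),

uniformly `φ₂ + (if d then 1 else 2) = β` (`fibreTwo_add_eq_card_block`).  It CONTAINS gen 33ʼs TWIST FIBRE LAW for `j ≥ 1`
(`Census/CoinvariantTwistLaw`: `G = ⟨u⟩ × B`, `w` = the `⟨u⟩`-coordinate, `d = 1 − [∃ b ∈ B, 2ʲ⁺¹ ∣ ord b]`) and extends it to every group in
which `c` survives in a cyclic quotient of order `≥ 4`: the fibre products `B̄ ×_ε ℤ/2ᵏ` — metacyclic `ℤ/m ⋊ ℤ/2ᵏ`, `ℤ/4 ⋊ ℤ/4` (`c = y²`: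
`d = 1`, `18 = 19 − 1`; `c = x²y²`: `d = 0`, `19 = 21 − 2`), `Q₈ ×_ε ℤ/4` (`d = 0`), `Q₈ ×_ε ℤ/8` (`d = 1`), … (numerics in part I).

THE ODD-KERNEL LAW (§3).  If every element of the kernel of `w` has odd order — `G = N ⋊ ℤ/2ᵏ` with `|N|` odd, i.e. EVERY finite group with a
CYCLIC Sylow `2`-subgroup of order `≥ 4` whose involution is central — then `d = 1` (part I §5), so **`φ₂(G, c) + 1 = β(G, c)`**
(`fibreTwo_add_one_eq_card_block_of_odd`), the non-roots of `c` are exactly the kernel, and Burnside reads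
**`β(G, c) · |G| = Σ_{g : w g = 0} 2^{|G| / (2·ord g)}`** (`card_block_mul_card_of_odd`).  For the metacyclic column `ℤ/m ⋊ ℤ/2ᵏ` (`m` odd):
`β = (Σ_{d ∣ m} φ(d)·2^{2ᵏ⁻¹ m / d}) / (2ᵏ m)`, e.g. `ℤ/3 ⋊ ℤ/8`: `β = (2¹² + 2·2⁴)/24 = 172`, `φ₂ = 171` (gen 40 numerics ✓).

THE FLOORS (§4).  Every finite family `S` of integer HODGE vectors whose translates generate the faces modulo pairs has **`β ≤ |S| + 2`** in the
whole class (`card_block_le_card_add_two`), **`β ≤ |S| + 1`** when `d = 1` (`card_block_le_card_add_one`), in particular for every odd kernel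
(`card_block_le_card_add_one_of_odd`): **`μ(ℤ/m ⋊ ℤ/2ᵏ) ≥ β − 1`** — the lower half of the metacyclic column left open in
`HOME/pub-hodgecm2-b09/lean-g40/RELATIVE-SPLITTING.md` (upper half `μ ≤ β − 1`: open for `k ≥ 3`; `k = 2` is seat b23ʼs dicyclic law).

## References
* [Pohlmann1968] H. Pohlmann, Algebraic cycles on abelian varieties of complex multiplication type, Ann. of Math. 88 (1968), Thm 1.
* [Milne1999] J. S. Milne, Lefschetz motives and the Tate conjecture, Compositio Math. 117 (1999), Prop. 2.1, p. 54.
-/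

namespace Summit.HodgeConjecture.CorCM.Census.CyclicCharacter

open Summit.HodgeConjecture.CorCM.Prior.AllgGroup.RfwfAllgGroup
open Summit.HodgeConjecture.CorCM.Census.BlockParity
open Summit.HodgeConjecture.CorCM.Census.Coinvariant
open Summit.HodgeConjecture.CorCM.Census.TypeStabiliser
open Summit.HodgeConjecture.CorCM.Census.IndexTwo
open Summit.HodgeConjecture.CorCM.Census.HalfParity

section Law

variable {G : Type*} [Group G] {k : ℕ} {w : G → ZMod (2 ^ k)} {c : G}

/-! ## §1 The even part exists -/

/-- The parity `g ↦ (w g).val mod 2` is additive (`2 ∣ 2ᵏ`, `k ≥ 1`). [folklore] -/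
theorem parity_add (hw : ∀ P Q : G, w (P * Q) = w P + w Q) (hk : 1 ≤ k) (a b : G) :
    (((w (a * b)).val : ℕ) : ZMod 2) = (((w a).val : ℕ) : ZMod 2) + (((w b).val : ℕ) : ZMod 2) := by
  haveI : NeZero (2 ^ k) := ⟨pow_ne_zero _ two_ne_zero⟩
  rw [hw, ZMod.val_add, ← Nat.cast_add, ZMod.natCast_eq_natCast_iff', Nat.mod_mod_of_dvd _ (dvd_pow_self 2 (by omega))]

/-- **The even part `E = {g | w g even}` is a subgroup.** [folklore] -/
theorem exists_even (hw : ∀ P Q : G, w (P * Q) = w P + w Q) (hk : 1 ≤ k) :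
    ∃ E : Subgroup G, ∀ g : G, g ∈ E ↔ 2 ∣ (w g).val :=
  ⟨addKer (fun g => (((w g).val : ℕ) : ZMod 2)) (parity_add hw hk), fun g => by
    rw [mem_addKer, ZMod.natCast_eq_zero_iff]⟩

variable [Fintype G] [DecidableEq G]

/-! ## §2 THE LAW `φ₂ + 2 = β + d` -/

/-- **THE CYCLIC-CHARACTER FIBRE LAW, `d = 1`: `φ₂(G, c) + 1 = β(G, c)`** when every `g` with `w g` odd is a root of `c`
(`c` central, `w : G → ℤ/2ᵏ` additive, `k ≥ 2`, onto, `w c ≠ 0`). [folklore] -/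
theorem fibreTwo_add_one_eq_card_block (hw : ∀ P Q : G, w (P * Q) = w P + w Q) (hk : 2 ≤ k) (h1 : ∃ g₁ : G, w g₁ = 1)
    (hc2 : c * c = 1) (hcen : ∀ x : G, x * c = c * x) (hwc : w c ≠ 0)
    (hroots : ∀ g : G, ¬ 2 ∣ (w g).val → c ∈ Subgroup.zpowers g) :
    fibreTwo c hc2 + 1 = Fintype.card (Block c) := by
  obtain ⟨E, hE⟩ := exists_even hw (by omega)
  have key := fibreTwo_add_eq_card_block_add_indexTwoRank c hc2 (c_ne_one hw hwc) hcen
  rw [if_pos (even_card_div_two hE hw hk h1 hc2 hwc),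
    indexTwoRank_stabGen_eq_one hE hw hk h1 hc2 hcen hwc (fun g hg => hroots g (by rwa [hE] at hg))] at key
  omega

/-- **THE CYCLIC-CHARACTER FIBRE LAW, `d = 0`: `φ₂(G, c) + 2 = β(G, c)`** when some `g` with `w g` odd is a non-root of `c`. [folklore] -/
theorem fibreTwo_add_two_eq_card_block (hw : ∀ P Q : G, w (P * Q) = w P + w Q) (hk : 2 ≤ k) (h1 : ∃ g₁ : G, w g₁ = 1)
    (hc2 : c * c = 1) (hcen : ∀ x : G, x * c = c * x) (hwc : w c ≠ 0)
    (hnon : ∃ g : G, ¬ 2 ∣ (w g).val ∧ c ∉ Subgroup.zpowers g) :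
    fibreTwo c hc2 + 2 = Fintype.card (Block c) := by
  obtain ⟨E, hE⟩ := exists_even hw (by omega)
  have key := fibreTwo_add_eq_card_block_add_indexTwoRank c hc2 (c_ne_one hw hwc) hcen
  obtain ⟨g, hg, hgc⟩ := hnon
  rw [if_pos (even_card_div_two hE hw hk h1 hc2 hwc),
    indexTwoRank_stabGen_eq_zero hE hw hk h1 hcen hwc ⟨g, by rwa [hE], hgc⟩] at key
  omega

/-- **THE CYCLIC-CHARACTER FIBRE LAW, uniform form: `φ₂(G, c) + (if d then 1 else 2) = β(G, c)`**, `d = [every w-odd element is a root of c]`.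
[folklore] -/
theorem fibreTwo_add_eq_card_block (hw : ∀ P Q : G, w (P * Q) = w P + w Q) (hk : 2 ≤ k) (h1 : ∃ g₁ : G, w g₁ = 1)
    (hc2 : c * c = 1) (hcen : ∀ x : G, x * c = c * x) (hwc : w c ≠ 0) :
    fibreTwo c hc2 + (if (∀ g : G, ¬ 2 ∣ (w g).val → c ∈ Subgroup.zpowers g) then 1 else 2) = Fintype.card (Block c) := by
  split_ifs with h
  · exact fibreTwo_add_one_eq_card_block hw hk h1 hc2 hcen hwc h
  · push Not at h
    exact fibreTwo_add_two_eq_card_block hw hk h1 hc2 hcen hwc h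

/-- **`β ≤ φ₂ + 2` throughout the class** (`d₂(G/𝒦) ≤ 1`). [folklore] -/
theorem card_block_le_fibreTwo_add_two (hw : ∀ P Q : G, w (P * Q) = w P + w Q) (hk : 2 ≤ k) (h1 : ∃ g₁ : G, w g₁ = 1)
    (hc2 : c * c = 1) (hcen : ∀ x : G, x * c = c * x) (hwc : w c ≠ 0) :
    Fintype.card (Block c) ≤ fibreTwo c hc2 + 2 := by
  have h := fibreTwo_add_eq_card_block hw hk h1 hc2 hcen hwc
  split_ifs at h <;> omega

/-! ## §3 THE ODD-KERNEL LAW: `φ₂ + 1 = β`, `𝒦 = ker w·⟨c⟩`, Burnside over the kernel -/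

/-- **THE ODD-KERNEL LAW: `φ₂(G, c) + 1 = β(G, c)`** when every element of the kernel of `w` has odd order — every `N ⋊ ℤ/2ᵏ` with `|N|` odd
and the involution of `ℤ/2ᵏ` central (`k ≥ 2`): the metacyclic column `ℤ/m ⋊ ℤ/2ᵏ`, the dicyclic `Dic_m` (`m` odd), … . [folklore] -/
theorem fibreTwo_add_one_eq_card_block_of_odd (hw : ∀ P Q : G, w (P * Q) = w P + w Q) (hk : 2 ≤ k) (h1 : ∃ g₁ : G, w g₁ = 1)
    (hc2 : c * c = 1) (hcen : ∀ x : G, x * c = c * x) (hwc : w c ≠ 0) (hodd : ∀ g : G, w g = 0 → Odd (orderOf g)) :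
    fibreTwo c hc2 + 1 = Fintype.card (Block c) :=
  fibreTwo_add_one_eq_card_block hw hk h1 hc2 hcen hwc fun g hg =>
    c_mem_zpowers_of_apply_ne_zero hw (by omega) hc2 hcen hwc hodd fun h => hg (by rw [h, ZMod.val_zero]; exact dvd_zero 2)

/-- **BURNSIDE OVER THE ODD KERNEL: `β(G, c) · |G| = Σ_{g : w g = 0} 2^{|G|/(2·ord g)}`** — the non-roots of `c` are exactly the kernel of `w`
(part I `notMem_zpowers_iff_apply_eq_zero`) in b09 gen 28ʼs `card_block_mul_card`.  (`k ≥ 1` suffices here.) [folklore] -/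
theorem card_block_mul_card_of_odd (hw : ∀ P Q : G, w (P * Q) = w P + w Q) (hk : 1 ≤ k) (hc2 : c * c = 1)
    (hcen : ∀ x : G, x * c = c * x) (hwc : w c ≠ 0) (hodd : ∀ g : G, w g = 0 → Odd (orderOf g)) :
    Fintype.card (Block c) * Fintype.card G = ∑ g : G, if w g = 0 then 2 ^ (Fintype.card G / orderOf g / 2) else 0 := by
  rw [card_block_mul_card c hc2 hcen]
  refine Finset.sum_congr rfl fun g _ => ?_
  by_cases hg : w g = 0
  · rw [if_pos hg, if_neg ((notMem_zpowers_iff_apply_eq_zero hw hk hc2 hcen hwc hodd g).mpr hg)]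
  · rw [if_neg hg, if_pos]
    exact c_mem_zpowers_of_apply_ne_zero hw hk hc2 hcen hwc hodd hg

/-! ## §4 THE FLOORS for Hodge families -/

/-- **THE FLOOR, whole class: `β ≤ |S| + 2`** for every finite family `S` of integer HODGE vectors with `faces ⊆ P₀ + ℤ[G]·S` (`P₀ ⊆ ℤ⟨pairs⟩`).
[folklore] -/
theorem card_block_le_card_add_two (hw : ∀ P Q : G, w (P * Q) = w P + w Q) (hk : 2 ≤ k) (h1 : ∃ g₁ : G, w g₁ = 1)
    (hc2 : c * c = 1) (hcen : ∀ x : G, x * c = c * x) (hwc : w c ≠ 0)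
    (S : Finset (CMF G c →₀ ℤ)) (P₀ : Submodule ℤ (CMF G c →₀ ℤ)) (hP₀ : P₀ ≤ Submodule.span ℤ (pairSet c))
    (hS : (S : Set (CMF G c →₀ ℤ)) ⊆ hodgeSpan c hc2)
    (hX : gfaceSet G c hc2 ⊆ ↑(P₀ ⊔ Submodule.span ℤ (translates c S))) :
    Fintype.card (Block c) ≤ S.card + 2 := by
  have hfloor := fibreTwo_le_card c hc2 hcen S P₀ hP₀ hS hX
  have hlaw := card_block_le_fibreTwo_add_two hw hk h1 hc2 hcen hwc
  omega

/-- **THE FLOOR, `d = 1`: `β ≤ |S| + 1`** — when every `w`-odd element is a root of `c`. [folklore] -/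
theorem card_block_le_card_add_one (hw : ∀ P Q : G, w (P * Q) = w P + w Q) (hk : 2 ≤ k) (h1 : ∃ g₁ : G, w g₁ = 1)
    (hc2 : c * c = 1) (hcen : ∀ x : G, x * c = c * x) (hwc : w c ≠ 0)
    (hroots : ∀ g : G, ¬ 2 ∣ (w g).val → c ∈ Subgroup.zpowers g)
    (S : Finset (CMF G c →₀ ℤ)) (P₀ : Submodule ℤ (CMF G c →₀ ℤ)) (hP₀ : P₀ ≤ Submodule.span ℤ (pairSet c))
    (hS : (S : Set (CMF G c →₀ ℤ)) ⊆ hodgeSpan c hc2)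
    (hX : gfaceSet G c hc2 ⊆ ↑(P₀ ⊔ Submodule.span ℤ (translates c S))) :
    Fintype.card (Block c) ≤ S.card + 1 := by
  have hfloor := fibreTwo_le_card c hc2 hcen S P₀ hP₀ hS hX
  have hlaw := fibreTwo_add_one_eq_card_block hw hk h1 hc2 hcen hwc hroots
  omega

/-- **THE FLOOR FOR THE ODD KERNEL: `β ≤ |S| + 1`** — e.g. `μ(ℤ/m ⋊ ℤ/2ᵏ, c) ≥ β − 1` for the whole metacyclic column, for families of integer
Hodge vectors of any kind (faces, `σ`-reads, weight relations, …). [folklore] -/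
theorem card_block_le_card_add_one_of_odd (hw : ∀ P Q : G, w (P * Q) = w P + w Q) (hk : 2 ≤ k) (h1 : ∃ g₁ : G, w g₁ = 1)
    (hc2 : c * c = 1) (hcen : ∀ x : G, x * c = c * x) (hwc : w c ≠ 0) (hodd : ∀ g : G, w g = 0 → Odd (orderOf g))
    (S : Finset (CMF G c →₀ ℤ)) (P₀ : Submodule ℤ (CMF G c →₀ ℤ)) (hP₀ : P₀ ≤ Submodule.span ℤ (pairSet c))
    (hS : (S : Set (CMF G c →₀ ℤ)) ⊆ hodgeSpan c hc2)
    (hX : gfaceSet G c hc2 ⊆ ↑(P₀ ⊔ Submodule.span ℤ (translates c S))) :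
    Fintype.card (Block c) ≤ S.card + 1 := by
  have hfloor := fibreTwo_le_card c hc2 hcen S P₀ hP₀ hS hX
  have hlaw := fibreTwo_add_one_eq_card_block_of_odd hw hk h1 hc2 hcen hwc hodd
  omega

/-- **The face form of the odd-kernel floor**: every family `S` of FACES whose base changes generate `hodgeSpan` modulo pairs has `β ≤ |S| + 1`;
with the matching family this is `μ(G, c) = β − 1` (open for `ℤ/m ⋊ ℤ/2ᵏ`, `k ≥ 3`). [folklore] -/
theorem card_block_le_card_faces_add_one_of_odd (hw : ∀ P Q : G, w (P * Q) = w P + w Q) (hk : 2 ≤ k) (h1 : ∃ g₁ : G, w g₁ = 1)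
    (hc2 : c * c = 1) (hcen : ∀ x : G, x * c = c * x) (hwc : w c ≠ 0) (hodd : ∀ g : G, w g = 0 → Odd (orderOf g))
    (S : Finset (CMF G c →₀ ℤ)) (hS : (S : Set (CMF G c →₀ ℤ)) ⊆ gfaceSet G c hc2)
    (hgen : hodgeSpan c hc2 ≤ Submodule.span ℤ (pairSet c) ⊔ Submodule.span ℤ (translates c S)) :
    Fintype.card (Block c) ≤ S.card + 1 := by
  have hfloor := fibreTwo_le_card_of_faces c hc2 hcen S hS fun y hy => hgen (gfaceSet_subset_hodgeSpan c hc2 hy)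
  have hlaw := fibreTwo_add_one_eq_card_block_of_odd hw hk h1 hc2 hcen hwc hodd
  omega

/-- **`β − 1` is a lower bound of the face census** of every odd-kernel `(G, c)` (the `IsLeast` shape of the laneʼs laws). [folklore] -/
theorem card_block_sub_one_mem_lowerBounds_of_odd (hw : ∀ P Q : G, w (P * Q) = w P + w Q) (hk : 2 ≤ k) (h1 : ∃ g₁ : G, w g₁ = 1)
    (hc2 : c * c = 1) (hcen : ∀ x : G, x * c = c * x) (hwc : w c ≠ 0) (hodd : ∀ g : G, w g = 0 → Odd (orderOf g)) :
    Fintype.card (Block c) - 1 ∈ lowerBounds {n : ℕ | ∃ S : Finset (CMF G c →₀ ℤ), (↑S ⊆ gfaceSet G c hc2) ∧ S.card = n ∧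
      hodgeSpan c hc2 ≤ Submodule.span ℤ (pairSet c) ⊔ Submodule.span ℤ (translates c S)} := by
  rintro n ⟨S, hS, rfl, hgen⟩
  have h := card_block_le_card_faces_add_one_of_odd hw hk h1 hc2 hcen hwc hodd S hS hgen
  omega

/-- **In the odd-kernel class the law `μ = φ₂` READS `μ = β − 1`**: `φ₂(G, c) = β(G, c) − 1`. [folklore] -/
theorem fibreTwo_eq_card_block_sub_one_of_odd (hw : ∀ P Q : G, w (P * Q) = w P + w Q) (hk : 2 ≤ k) (h1 : ∃ g₁ : G, w g₁ = 1)
    (hc2 : c * c = 1) (hcen : ∀ x : G, x * c = c * x) (hwc : w c ≠ 0) (hodd : ∀ g : G, w g = 0 → Odd (orderOf g)) :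
    fibreTwo c hc2 = Fintype.card (Block c) - 1 := by
  have h := fibreTwo_add_one_eq_card_block_of_odd hw hk h1 hc2 hcen hwc hodd
  omega

end Law

end Summit.HodgeConjecture.CorCM.Census.CyclicCharacter
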